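import Summits.AtomisticToContinuum.Crystallization.Theorems.FreeSplittingCertificatesStrictSplittingRuleP1NearLemmas

/-!
# `StrictSplittingRule` (stmt-AtomisticToContinuum-12560): THE NEAR REDUCTION — the near-ledger inequality `hNear` from the finite near form and the far-site certificates (G9; P1 interpolant object, part 59; lemmas in part 59a)

Route `FreeSplittingCertificates`, crux r3 `StrictSplittingRule` (H12⋆ = `stub_coreJointCoercive`), unit b2b-freesplit-B gen 33.
VALUE = the IDENTIFICATION half of gap G9 of the kernel assembly map (HOME FAR-LEMMA-SPEC §23 (e)): the near-ledger hypothesis `hNear` of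
`coreJointSiteIneq_of_ledgers` / `coreJointCoercive_of_ledgers` (an inequality between infinite series of `u`, for every skew least-squares co-rotation
`W`) FOLLOWS from five finite / sitewise statements about explicit data — the shape in which the cell's certificates exist:
  (NC)  `0 ≤ p1NearForm … V` for every `V : ℤ³ → ℝ³` with `V p = 0` and the first-shell moment condition (the near certificate, CERT §30 (3));
  (S)   per-site domination off the reach set `QB`: `0 ≤ ½(W′|z|² + 2W″⟪d_q,z⟫²) + H_rad,q(z) − H_cred,q(z)` (CERT §29–§30, incl. the tail);
  (TAB) the hat-average tables on `QB`: `L q·⟪d_q,z⟫² ≤ H_rad,q(z)`, `H_cred,q(z) ≤ U q·|z|²`;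
  (PAY) column-sum enclosures of the far table: `κ(2/5)a⁻⁴·Σ'_q p1RecTable(b_p)(q−p)(s) ≤ PAYM s`;
  (FLX) the flux enclosure on the collar cells: `Σ_{T∈CELLS} p1FluxQuad₀(T)(vals) ≤ p1NearFlux F₀ Δ QF vals`;
together with kernel-side bookkeeping hypotheses on the index sets (the first shell `SH` as a finset, the near tables vanish off `QT`, the cell flux form
vanishes off `CELLS`, the far shares take at least the full load off `LEG`, the column sums `colβ` of `β`).  `H_rad/cred,q(z) = p1SiteBare` with the
ledger's weights re-centred at `y_p` applied to the constant value `z`.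
Proof: every series of `hNear` is rewritten in the lattice values `V = p1DispSite a h u (u_p − y_p·A) A` (`V p = 0`, `W` skew ⇒ stretches and radial
components do not see `W`), split into its part over the finite index set plus a remainder which is dropped by sign ((S), far shares ≥ load) or vanishes
(tables off `QT`, flux form off `CELLS`); the moment condition is the first-order optimality of `W` among skew maps.
NOT a proof of H12⋆ (the five statements are certificate-tier hypotheses), NOT summit progress.  [folklore]
-/

noncomputable section

open Set Function Metric MeasureTheory Filter Topology
open scoped BigOperators NNReal ENNReal Classical

namespace Summit.AtomisticToContinuum.Crystallization.Theorems.StrictSplittingRuleBirth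

open Literature.MathematicalPhysics.StatisticalMechanics
open Summit.AtomisticToContinuum.Crystallization.Theorems.PalmUnimodularRigidity.LayeredLawsSelectHcp
open Summit.AtomisticToContinuum.Crystallization.Theorems.PhononStabilityCWC.Cert (inner_fin3)

/-! ## THE NEAR REDUCTION -/

/-- **THE NEAR REDUCTION.**  See the module docstring: the near-ledger inequality of `coreJointSiteIneq_of_ledgers` at `p`, for the displacement `u`, the skew
least-squares co-rotation `W` (matrix `A`), the far shares `w`, `(sv, wv)` and the ledger's constants, from (NC) + (S) + (TAB) + (PAY) + (FLX) and the index-set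
bookkeeping.  NOT a proof of H12⋆, NOT summit progress. -/
theorem nearLedger_of_finite {a h κ₁ κ₃ : ℝ} (ha : 0 < a) (hh : 0 < h)
    (Y₁ : Finset (ℤ × ℤ × ℤ)) (β : Bool → (ℤ × ℤ × ℤ) → (ℤ × ℤ × ℤ) → ℝ)
    {Cβ : ℝ} (hβ : ∀ p q : ℤ × ℤ × ℤ, ∀ s, |β (decide (Even p.1)) (q - p) s| ≤ Cβ * ((1 + ‖hcpSite a h q - hcpSite a h p‖)⁻¹) ^ 6)
    (M₁ N : Bool → (ℤ × ℤ × ℤ) → (ℤ × ℤ × ℤ) → (ℤ × ℤ × ℤ) → ℝ)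
    {R1 R2 : ℝ} (hR1 : 0 < R1) (hR12 : R1 < R2) {κ : ℝ} (hκ : 0 ≤ κ)
    (u : ℤ × ℤ × ℤ → EuclideanSpace ℝ (Fin 3)) (hu : (support u).Finite) (p : ℤ × ℤ × ℤ)
    (W : EuclideanSpace ℝ (Fin 3) →ₗ[ℝ] EuclideanSpace ℝ (Fin 3)) (hWskew : ∀ z : EuclideanSpace ℝ (Fin 3), inner ℝ (W z) z = 0)
    (hWLS : ∀ W' : EuclideanSpace ℝ (Fin 3) →ₗ[ℝ] EuclideanSpace ℝ (Fin 3), (∀ z : EuclideanSpace ℝ (Fin 3), inner ℝ (W' z) z = 0) →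
        (∑' q : ℤ × ℤ × ℤ,
            (if 0 < ‖hcpSite a h q - hcpSite a h p‖ ∧ ‖hcpSite a h q - hcpSite a h p‖ ≤ 11 / 10 * a then
              ‖u q - u p - W (hcpSite a h q - hcpSite a h p)‖ ^ 2 else (0 : ℝ))) ≤
        (∑' q : ℤ × ℤ × ℤ,
            (if 0 < ‖hcpSite a h q - hcpSite a h p‖ ∧ ‖hcpSite a h q - hcpSite a h p‖ ≤ 11 / 10 * a then
              ‖u q - u p - W' (hcpSite a h q - hcpSite a h p)‖ ^ 2 else (0 : ℝ))))
    (A : Fin 3 → Fin 3 → ℝ) (hA : ∀ (y : EuclideanSpace ℝ (Fin 3)) (k : Fin 3), W y k = y 0 * A 0 k + y 1 * A 1 k + y 2 * A 2 k)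
    (w : (ℤ × ℤ × ℤ) × (ℤ × ℤ × ℤ) → ℝ) (hw : ∀ e, 0 ≤ w e)
    (hws : Summable fun e : (ℤ × ℤ × ℤ) × (ℤ × ℤ × ℤ) => w e * fpSq (fun k => hcpSite a h (e.1 + e.2) k - hcpSite a h e.1 k))
    (sv : ℤ × ℤ × ℤ) (wv : ℤ × ℤ × ℤ → ℝ) (hwv : ∀ q, 0 ≤ wv q) (hwvs : Summable wv)
    -- the explicit first shell
    (SH : Finset (ℤ × ℤ × ℤ))
    (hSH : ∀ q : ℤ × ℤ × ℤ, (0 < ‖hcpSite a h q - hcpSite a h p‖ ∧ ‖hcpSite a h q - hcpSite a h p‖ ≤ 11 / 10 * a) ↔ q ∈ SH)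
    -- (S) off the reach set and (TAB) on it
    (QB : Finset (ℤ × ℤ × ℤ)) (L U : (ℤ × ℤ × ℤ) → ℝ)
    (hS : ∀ q : ℤ × ℤ × ℤ, q ∉ QB → q ≠ p → ∀ z : Fin 3 → ℝ,
      0 ≤ 1 / 2 * (ljSqDeriv (‖hcpSite a h q - hcpSite a h p‖ ^ 2) * fpSq z +
          2 * (1 / 2 * (7 * ((‖hcpSite a h q - hcpSite a h p‖ ^ 2)⁻¹) ^ 8 -
            4 * ((‖hcpSite a h q - hcpSite a h p‖ ^ 2)⁻¹) ^ 5)) * p1NRad a h p (fun _ => z) q ^ 2) +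
        p1SiteBare a h (fun y k l => κ * ((7 * (5 / 4 : ℝ) + 3 / 4) / 4) * fpChi (R1 ^ 2) (R2 ^ 2) (y - fun k => hcpSite a h p k) ^ 2 *
          (fpSq (y - fun k => hcpSite a h p k))⁻¹ ^ 5 * ((y - fun k => hcpSite a h p k) k * (y - fun k => hcpSite a h p k) l)) (fun _ => z) q -
        p1SiteBare a h (fun y k l => κ * ((3 / 4 : ℝ) / 4) * fpChi (R1 ^ 2) (R2 ^ 2) (y - fun k => hcpSite a h p k) ^ 2 *
          (fpSq (y - fun k => hcpSite a h p k))⁻¹ ^ 4 * (if k = l then 1 else 0)) (fun _ => z) q)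
    (hTab : ∀ q ∈ QB, q ≠ p → ∀ z : Fin 3 → ℝ,
      L q * p1NRad a h p (fun _ => z) q ^ 2 ≤
        p1SiteBare a h (fun y k l => κ * ((7 * (5 / 4 : ℝ) + 3 / 4) / 4) * fpChi (R1 ^ 2) (R2 ^ 2) (y - fun k => hcpSite a h p k) ^ 2 *
          (fpSq (y - fun k => hcpSite a h p k))⁻¹ ^ 5 * ((y - fun k => hcpSite a h p k) k * (y - fun k => hcpSite a h p k) l)) (fun _ => z) q ∧
      p1SiteBare a h (fun y k l => κ * ((3 / 4 : ℝ) / 4) * fpChi (R1 ^ 2) (R2 ^ 2) (y - fun k => hcpSite a h p k) ^ 2 *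
          (fpSq (y - fun k => hcpSite a h p k))⁻¹ ^ 4 * (if k = l then 1 else 0)) (fun _ => z) q ≤ U q * fpSq z)
    -- the near tables vanish off QT
    (QT : Finset (ℤ × ℤ × ℤ))
    (hQT : ∀ q : ℤ × ℤ × ℤ, q ∉ QT → ∀ s s', M₁ (decide (Even p.1)) (q - p) s s' = 0 ∧ M₁ (decide (Even q.1)) (p - q) s s' = 0 ∧
      N (decide (Even p.1)) (q - p) s s' = 0 ∧ N (decide (Even q.1)) (p - q) s' s = 0)
    -- the far shares take at least the full load off LEG
    (LEG : Finset ((ℤ × ℤ × ℤ) × (ℤ × ℤ × ℤ)))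
    (hwfar : ∀ e : (ℤ × ℤ × ℤ) × (ℤ × ℤ × ℤ), e ∉ LEG →
      (if e.1 ≠ p ∧ e.2 ∈ Y₁ then 1 / 2 * β (decide (Even e.1.1)) (p - e.1) e.2 else 0) ≤ w e + (if e.2 = sv then wv e.1 else 0))
    -- the column sums of β
    (colβ : (ℤ × ℤ × ℤ) → ℝ)
    (hcol : ∀ s ∈ Y₁, HasSum (fun q : ℤ × ℤ × ℤ => if q = p then (0 : ℝ) else β (decide (Even p.1)) (q - p) s) (colβ s))
    -- (PAY)
    (PAYM : (ℤ × ℤ × ℤ) → ℝ)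
    (hPAY : ∀ s ∈ p1BondOffsets, κ * (2 / 5) / a ^ 4 *
      (∑' q : ℤ × ℤ × ℤ, p1RecTable a h (p1SplitDensity R1 R2) (decide (Even p.1)) (q - p) s) ≤ PAYM s)
    -- the flux form vanishes off CELLS and (FLX)
    (CELLS : Finset ((ℤ × ℤ × ℤ) × Fin 6))
    (hCELLS : ∀ i, i ∉ CELLS → ∀ Wv : Fin 4 → Fin 3 → ℝ,
      p1FluxQuad₀ (R1 ^ 2) (R2 ^ 2) (1 / 3) (4 / 3) (-9 / 8) (1 / 8) a h (fun k => hcpSite a h p k) i Wv = 0)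
    (QF : Finset (ℤ × ℤ × ℤ)) (FL0 : (ℤ × ℤ × ℤ) × Fin 3 → (ℤ × ℤ × ℤ) × Fin 3 → ℝ) (Δ : (ℤ × ℤ × ℤ) → ℝ)
    (hFlux : ∀ V : ℤ × ℤ × ℤ → (Fin 3 → ℝ),
      ∑ i ∈ CELLS, p1FluxQuad₀ (R1 ^ 2) (R2 ^ 2) (1 / 3) (4 / 3) (-9 / 8) (1 / 8) a h (fun k => hcpSite a h p k) i (p1CellVals V i) ≤
        p1NearFlux FL0 Δ QF V)
    -- (NC) the near certificate on the least-squares constraint set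
    (hNC : ∀ V : ℤ × ℤ × ℤ → (Fin 3 → ℝ), V p = 0 →
      (∀ Z : Fin 3 → Fin 3 → ℝ, (∀ j k, Z j k = -Z k j) →
        ∑ q ∈ SH, ∑ k : Fin 3, V q k * (∑ j : Fin 3, (hcpSite a h q j - hcpSite a h p j) * Z j k) = 0) →
      0 ≤ p1NearForm a h κ₁ κ₃ κ p Y₁ β M₁ N w sv wv colβ SH QB QT QF LEG L U PAYM Δ FL0 V) :
    κ₁ * (∑' q : ℤ × ℤ × ℤ,
        (if 0 < ‖hcpSite a h q - hcpSite a h p‖ ∧ ‖hcpSite a h q - hcpSite a h p‖ ≤ 11 / 10 * a then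
          (inner ℝ (hcpSite a h q - hcpSite a h p) (u q - u p)) ^ 2 else (0 : ℝ))) +
      κ₃ * (∑' q : ℤ × ℤ × ℤ,
        (if 0 < ‖hcpSite a h q - hcpSite a h p‖ ∧ ‖hcpSite a h q - hcpSite a h p‖ ≤ 11 / 10 * a then
          ‖u q - u p - W (hcpSite a h q - hcpSite a h p)‖ ^ 2 else (0 : ℝ))) +
      (∑' q : ℤ × ℤ × ℤ, (if q = p then (0 : ℝ) else
        ∑ s ∈ Y₁,
          (β (decide (Even q.1)) (p - q) s *
              (1 / 2 * ‖u (q + s) - u q - W (hcpSite a h (q + s) - hcpSite a h q)‖ ^ 2) -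
            β (decide (Even p.1)) (q - p) s *
              (1 / 2 * ‖u (p + s) - u p - W (hcpSite a h (p + s) - hcpSite a h p)‖ ^ 2)))) -
      ((∑' e : (ℤ × ℤ × ℤ) × (ℤ × ℤ × ℤ), w e * ‖u (e.1 + e.2) - u e.1 - W (hcpSite a h (e.1 + e.2) - hcpSite a h e.1)‖ ^ 2) +
    (∑' q : ℤ × ℤ × ℤ, wv q * ‖u (q + sv) - u q - W (hcpSite a h (q + sv) - hcpSite a h q)‖ ^ 2) +
    (∑' q, p1SiteBare a h (fun y k l => κ * ((7 * (5 / 4 : ℝ) + 3 / 4) / 4) * fpChi (R1 ^ 2) (R2 ^ 2) (y - fun k => hcpSite a h p k) ^ 2 *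
        (fpSq (y - fun k => hcpSite a h p k))⁻¹ ^ 5 * ((y - fun k => hcpSite a h p k) k * (y - fun k => hcpSite a h p k) l))
        (fun n k => p1DispSite a h (fun n k => u n k) (fun k => u p k - (hcpSite a h p 0 * A 0 k + hcpSite a h p 1 * A 1 k + hcpSite a h p 2 * A 2 k)) A n k) q) -
    (∑' q, p1SiteBare a h (fun y k l => κ * ((3 / 4 : ℝ) / 4) * fpChi (R1 ^ 2) (R2 ^ 2) (y - fun k => hcpSite a h p k) ^ 2 *
        (fpSq (y - fun k => hcpSite a h p k))⁻¹ ^ 4 * (if k = l then 1 else 0))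
        (fun n k => p1DispSite a h (fun n k => u n k) (fun k => u p k - (hcpSite a h p 0 * A 0 k + hcpSite a h p 1 * A 1 k + hcpSite a h p 2 * A 2 k)) A n k) q)) -
      (∑' q : ℤ × ℤ × ℤ, (if q = p then (0 : ℝ) else
        1 / 2 * (ljSqDeriv (‖hcpSite a h q - hcpSite a h p‖ ^ 2) *
            ‖u q - u p - W (hcpSite a h q - hcpSite a h p)‖ ^ 2 +
          2 * (1 / 2 * (7 * ((‖hcpSite a h q - hcpSite a h p‖ ^ 2)⁻¹) ^ 8 -
            4 * ((‖hcpSite a h q - hcpSite a h p‖ ^ 2)⁻¹) ^ 5)) *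
            (inner ℝ (hcpSite a h q - hcpSite a h p) (u q - u p)) ^ 2))) -
      (∑' q : ℤ × ℤ × ℤ, (if q = p then (0 : ℝ) else
        ∑ s ∈ p1BondOffsets, ∑ s' ∈ p1BondOffsets,
          (M₁ (decide (Even p.1)) (q - p) s s' *
              (inner ℝ (hcpSite a h (p + s) - hcpSite a h p) (u (p + s) - u p) *
                inner ℝ (hcpSite a h (p + s') - hcpSite a h p) (u (p + s') - u p)) -
            M₁ (decide (Even q.1)) (p - q) s s' *
              (inner ℝ (hcpSite a h (q + s) - hcpSite a h q) (u (q + s) - u q) *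
                inner ℝ (hcpSite a h (q + s') - hcpSite a h q) (u (q + s') - u q)) +
            (N (decide (Even p.1)) (q - p) s s' - N (decide (Even q.1)) (p - q) s' s) *
              (inner ℝ (hcpSite a h (p + s) - hcpSite a h p) (u (p + s) - u p) *
                inner ℝ (hcpSite a h (q + s') - hcpSite a h q) (u (q + s') - u q))))) +
      κ * (2 / 5) / a ^ 4 * (∑' q : ℤ × ℤ × ℤ, if q = p then (0 : ℝ) else
        ∑ s ∈ p1BondOffsets, p1RecTable a h (p1SplitDensity R1 R2) (decide (Even p.1)) (q - p) s *
          (inner ℝ (hcpSite a h (p + s) - hcpSite a h p) (u (p + s) - u p)) ^ 2) +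
      κ * (2 / 5) / a ^ 4 * (∑ d ∈ p1BondOffsets, p1RecTable a h (p1SplitDensity R1 R2) (p1Par p) (p - p) d *
          (inner ℝ (hcpSite a h (p + d) - hcpSite a h p) (u (p + d) - u p)) ^ 2) +
      κ * (∑' i, p1FluxQuad₀ (R1 ^ 2) (R2 ^ 2) (1 / 3) (4 / 3) (-9 / 8) (1 / 8) a h (fun k => hcpSite a h p k) i
        (p1CellVals (fun n k => p1DispSite a h (fun n k => u n k) (fun k => u p k - (hcpSite a h p 0 * A 0 k + hcpSite a h p 1 * A 1 k + hcpSite a h p 2 * A 2 k)) A n k) i)) ≤ 0 := by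
  have ha' := ha.ne'
  have hh' := hh.ne'
  have hS1 : 0 < R1 ^ 2 := pow_pos hR1 2
  have hS12 : R1 ^ 2 < R2 ^ 2 := pow_lt_pow_left₀ hR12 hR1.le two_ne_zero
  have hP : ∀ q : ℤ × ℤ × ℤ, p1Par q = decide (Even q.1) := fun q => rfl
  -- the far-ledger field and its values
  set b₀ : Fin 3 → ℝ := fun k => u p k - (hcpSite a h p 0 * A 0 k + hcpSite a h p 1 * A 1 k + hcpSite a h p 2 * A 2 k) with hb₀
  set V : ℤ × ℤ × ℤ → (Fin 3 → ℝ) := fun n k => p1DispSite a h (fun n k => u n k) b₀ A n k with hVdef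
  have hU : (support fun n => fun k => u n k).Finite := by
    refine hu.subset fun n hn => ?_
    simp only [mem_support, ne_eq] at hn ⊢
    intro h0
    apply hn
    funext k
    rw [h0]
    rfl
  have hVapp : ∀ q k, V q k = u q k - u p k - ((hcpSite a h q 0 - hcpSite a h p 0) * A 0 k + (hcpSite a h q 1 - hcpSite a h p 1) * A 1 k +
      (hcpSite a h q 2 - hcpSite a h p 2) * A 2 k) := by
    intro q k
    rw [hVdef]
    dsimp only
    rw [p1DispSite_apply ha' hh', hb₀]
    ring
  have hVp : V p = 0 := by
    funext k
    rw [hVapp, Pi.zero_apply]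
    ring
  -- (1) bond readouts
  have hR : ∀ q s, ‖u (q + s) - u q - W (hcpSite a h (q + s) - hcpSite a h q)‖ ^ 2 = p1NRead V q s := fun q s =>
    norm_sq_coreReadout_eq_fpSq ha' hh' u W A hA b₀ q s
  -- (2) single-site norms
  have hR1' : ∀ q, ‖u q - u p - W (hcpSite a h q - hcpSite a h p)‖ ^ 2 = fpSq (V q) := by
    intro q
    have h1 := hR p (q - p)
    rw [add_sub_cancel] at h1
    rw [h1, p1NRead, add_sub_cancel, hVp]
    simp only [Pi.zero_apply, sub_zero]
  -- (3) radial components and stretches do not see W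
  have hWz : ∀ z : EuclideanSpace ℝ (Fin 3), z 0 * (z 0 * A 0 0 + z 1 * A 1 0 + z 2 * A 2 0) + z 1 * (z 0 * A 0 1 + z 1 * A 1 1 + z 2 * A 2 1) +
      z 2 * (z 0 * A 0 2 + z 1 * A 1 2 + z 2 * A 2 2) = 0 := by
    intro z
    have h0 := hWskew z
    rw [inner_fin3, hA, hA, hA] at h0
    linarith
  have hRad : ∀ q, inner ℝ (hcpSite a h q - hcpSite a h p) (u q - u p) = p1NRad a h p V q := by
    intro q
    have h0 := hWz (hcpSite a h q - hcpSite a h p)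
    simp only [PiLp.sub_apply] at h0
    rw [inner_fin3, p1NRad, Fin.sum_univ_three, hVapp, hVapp, hVapp]
    simp only [PiLp.sub_apply]
    linear_combination h0
  have hStr : ∀ q s, inner ℝ (hcpSite a h (q + s) - hcpSite a h q) (u (q + s) - u q) = p1NStr a h V q s := by
    intro q s
    have h0 := hWz (hcpSite a h (q + s) - hcpSite a h q)
    simp only [PiLp.sub_apply] at h0
    rw [inner_fin3, p1NStr, Fin.sum_univ_three, hVapp, hVapp, hVapp, hVapp, hVapp, hVapp]
    simp only [PiLp.sub_apply]
    linear_combination h0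
  -- (4) shell sums are finite sums over SH
  have hshell : ∀ f : ℤ × ℤ × ℤ → ℝ, (∑' q : ℤ × ℤ × ℤ,
      (if 0 < ‖hcpSite a h q - hcpSite a h p‖ ∧ ‖hcpSite a h q - hcpSite a h p‖ ≤ 11 / 10 * a then f q else 0)) = ∑ q ∈ SH, f q := by
    intro f
    rw [tsum_eq_sum (s := SH) fun q hq => if_neg fun hc => hq ((hSH q).1 hc)]
    exact Finset.sum_congr rfl fun q hq => if_pos ((hSH q).2 hq)
  -- (5) the moment condition of the least-squares co-rotation
  have hmom : ∀ Z : Fin 3 → Fin 3 → ℝ, (∀ j k, Z j k = -Z k j) →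
      ∑ q ∈ SH, ∑ k : Fin 3, V q k * (∑ j : Fin 3, (hcpSite a h q j - hcpSite a h p j) * Z j k) = 0 := by
    intro Z hZ
    simp only [hVapp]
    exact leastSquares_moment u p W hWskew hWLS A hA SH hSH Z hZ
  -- the near certificate at V
  have hnc := hNC V hVp hmom
  -- (6) SHELL: κ₁S₁ + κ₃S₃ = p1NearShell
  have hShell : κ₁ * (∑' q : ℤ × ℤ × ℤ,
        (if 0 < ‖hcpSite a h q - hcpSite a h p‖ ∧ ‖hcpSite a h q - hcpSite a h p‖ ≤ 11 / 10 * a then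
          (inner ℝ (hcpSite a h q - hcpSite a h p) (u q - u p)) ^ 2 else (0 : ℝ))) +
      κ₃ * (∑' q : ℤ × ℤ × ℤ,
        (if 0 < ‖hcpSite a h q - hcpSite a h p‖ ∧ ‖hcpSite a h q - hcpSite a h p‖ ≤ 11 / 10 * a then
          ‖u q - u p - W (hcpSite a h q - hcpSite a h p)‖ ^ 2 else (0 : ℝ))) = p1NearShell a h κ₁ κ₃ p SH V := by
    rw [hshell (fun q => (inner ℝ (hcpSite a h q - hcpSite a h p) (u q - u p)) ^ 2),
      hshell (fun q => ‖u q - u p - W (hcpSite a h q - hcpSite a h p)‖ ^ 2), p1NearShell]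
    simp only [hRad, hR1']
  -- (7) TRANSFERS: the near-table series is the finite sum over QT
  have hTr : (∑' q : ℤ × ℤ × ℤ, (if q = p then (0 : ℝ) else
        ∑ s ∈ p1BondOffsets, ∑ s' ∈ p1BondOffsets,
          (M₁ (decide (Even p.1)) (q - p) s s' *
              (inner ℝ (hcpSite a h (p + s) - hcpSite a h p) (u (p + s) - u p) *
                inner ℝ (hcpSite a h (p + s') - hcpSite a h p) (u (p + s') - u p)) -
            M₁ (decide (Even q.1)) (p - q) s s' *
              (inner ℝ (hcpSite a h (q + s) - hcpSite a h q) (u (q + s) - u q) *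
                inner ℝ (hcpSite a h (q + s') - hcpSite a h q) (u (q + s') - u q)) +
            (N (decide (Even p.1)) (q - p) s s' - N (decide (Even q.1)) (p - q) s' s) *
              (inner ℝ (hcpSite a h (p + s) - hcpSite a h p) (u (p + s) - u p) *
                inner ℝ (hcpSite a h (q + s') - hcpSite a h q) (u (q + s') - u q))))) = p1NearTransfer a h p M₁ N QT V := by
    simp only [hStr]
    rw [p1NearTransfer, tsum_eq_sum (s := QT) fun q hq => ?_]
    split_ifs
    · rfl
    · refine Finset.sum_eq_zero fun s _ => Finset.sum_eq_zero fun s' _ => ?_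
      obtain ⟨h1, h2, h3, h4⟩ := hQT q hq s s'
      rw [h1, h2, h3, h4]
      ring
  -- (8) FLUX: the cell series is the finite sum over CELLS, then the enclosure
  have hFl : κ * (∑' i, p1FluxQuad₀ (R1 ^ 2) (R2 ^ 2) (1 / 3) (4 / 3) (-9 / 8) (1 / 8) a h (fun k => hcpSite a h p k) i (p1CellVals V i)) ≤
      κ * p1NearFlux FL0 Δ QF V := by
    rw [tsum_eq_sum (s := CELLS) fun i hi => hCELLS i hi _]
    exact mul_le_mul_of_nonneg_left (hFlux V) hκ
  -- (9) PAYMENTS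
  have hPay : κ * (2 / 5) / a ^ 4 * (∑' q : ℤ × ℤ × ℤ, if q = p then (0 : ℝ) else
        ∑ s ∈ p1BondOffsets, p1RecTable a h (p1SplitDensity R1 R2) (decide (Even p.1)) (q - p) s *
          (inner ℝ (hcpSite a h (p + s) - hcpSite a h p) (u (p + s) - u p)) ^ 2) +
      κ * (2 / 5) / a ^ 4 * (∑ d ∈ p1BondOffsets, p1RecTable a h (p1SplitDensity R1 R2) (p1Par p) (p - p) d *
          (inner ℝ (hcpSite a h (p + d) - hcpSite a h p) (u (p + d) - u p)) ^ 2) ≤ p1NearPay a h p PAYM V := by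
    simp only [hStr, hP]
    obtain ⟨CR, hCR⟩ := p1RecTable_fpChi_decay ha hh hR1 hR12
    have hRdec : ∀ q s, |p1RecTable a h (p1SplitDensity R1 R2) (decide (Even p.1)) (q - p) s| ≤
        CR * ((1 + ‖hcpSite a h q - hcpSite a h p‖)⁻¹) ^ 6 := by
      intro q s
      have h1 := (hCR q p s).2
      rw [norm_sub_rev] at h1
      exact h1
    have hR0 : ∀ q s, 0 ≤ p1RecTable a h (p1SplitDensity R1 R2) (decide (Even p.1)) (q - p) s := fun q s => (hCR q p s).1
    -- columns summable
    have hcolR : ∀ s, Summable fun q : ℤ × ℤ × ℤ => p1RecTable a h (p1SplitDensity R1 R2) (decide (Even p.1)) (q - p) s := fun s =>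
      summableTransfer_summable_of_abs_le ha hh p (hRdec · s)
    set c : (ℤ × ℤ × ℤ) → ℝ := fun s => p1NStr a h V p s ^ 2 with hc
    have hc0 : ∀ s, 0 ≤ c s := fun s => sq_nonneg _
    set f : (ℤ × ℤ × ℤ) → ℝ := fun q => ∑ s ∈ p1BondOffsets, p1RecTable a h (p1SplitDensity R1 R2) (decide (Even p.1)) (q - p) s * c s with hf
    have hfs : Summable f := summable_sum fun s _ => (hcolR s).mul_right _
    have hsplit := hfs.tsum_eq_add_tsum_ite p
    have htot : ∑' q, f q = ∑ s ∈ p1BondOffsets, (∑' q : ℤ × ℤ × ℤ, p1RecTable a h (p1SplitDensity R1 R2) (decide (Even p.1)) (q - p) s) * c s := by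
      rw [hf, Summable.tsum_finsetSum (fun s _ => (hcolR s).mul_right _)]
      exact Finset.sum_congr rfl fun s _ => by rw [tsum_mul_right]
    have hfp : f p = ∑ d ∈ p1BondOffsets, p1RecTable a h (p1SplitDensity R1 R2) (decide (Even p.1)) (p - p) d * c d := rfl
    have hite : (fun q => if q = p then (0 : ℝ) else f q) = fun q => if q = p then (0 : ℝ) else
        ∑ s ∈ p1BondOffsets, p1RecTable a h (p1SplitDensity R1 R2) (decide (Even p.1)) (q - p) s * c s := rfl
    have hkey : κ * (2 / 5) / a ^ 4 * (∑' q, f q) ≤ p1NearPay a h p PAYM V := by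
      rw [htot, p1NearPay, Finset.mul_sum]
      refine Finset.sum_le_sum fun s hs => ?_
      rw [← mul_assoc]
      exact mul_le_mul_of_nonneg_right (hPAY s hs) (hc0 s)
    have ht0 : 0 ≤ κ * (2 / 5) / a ^ 4 := by positivity
    have e1 : κ * (2 / 5) / a ^ 4 * (∑' q : ℤ × ℤ × ℤ, if q = p then (0 : ℝ) else
          ∑ s ∈ p1BondOffsets, p1RecTable a h (p1SplitDensity R1 R2) (decide (Even p.1)) (q - p) s * c s) +
        κ * (2 / 5) / a ^ 4 * (∑ d ∈ p1BondOffsets, p1RecTable a h (p1SplitDensity R1 R2) (decide (Even p.1)) (p - p) d * c d) =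
        κ * (2 / 5) / a ^ 4 * (∑' q, f q) := by
      rw [hsplit, hfp]
      ring
    rw [e1]
    exact hkey
  -- (10) READOUT: RF − far shares ≤ p1NearRead
  have hRead : (∑' q : ℤ × ℤ × ℤ, (if q = p then (0 : ℝ) else
        ∑ s ∈ Y₁,
          (β (decide (Even q.1)) (p - q) s *
              (1 / 2 * ‖u (q + s) - u q - W (hcpSite a h (q + s) - hcpSite a h q)‖ ^ 2) -
            β (decide (Even p.1)) (q - p) s *
              (1 / 2 * ‖u (p + s) - u p - W (hcpSite a h (p + s) - hcpSite a h p)‖ ^ 2)))) -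
      ((∑' e : (ℤ × ℤ × ℤ) × (ℤ × ℤ × ℤ), w e * ‖u (e.1 + e.2) - u e.1 - W (hcpSite a h (e.1 + e.2) - hcpSite a h e.1)‖ ^ 2) +
        (∑' q : ℤ × ℤ × ℤ, wv q * ‖u (q + sv) - u q - W (hcpSite a h (q + sv) - hcpSite a h q)‖ ^ 2)) ≤
      p1NearRead p Y₁ β w sv wv colβ LEG V :=
    readoutForm_sub_farShares_le_p1NearRead ha hh Y₁ β hβ u hu p W A hA b₀ w hw hws sv wv hwv hwvs LEG hwfar colβ hcol
  -- (11) BARE: p1NearBare ≤ BARE + FarBare_rad − FarBare_cred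
  have hBare : p1NearBare a h p QB L U V ≤
      (∑' q : ℤ × ℤ × ℤ, (if q = p then (0 : ℝ) else
        1 / 2 * (ljSqDeriv (‖hcpSite a h q - hcpSite a h p‖ ^ 2) *
            ‖u q - u p - W (hcpSite a h q - hcpSite a h p)‖ ^ 2 +
          2 * (1 / 2 * (7 * ((‖hcpSite a h q - hcpSite a h p‖ ^ 2)⁻¹) ^ 8 -
            4 * ((‖hcpSite a h q - hcpSite a h p‖ ^ 2)⁻¹) ^ 5)) *
            (inner ℝ (hcpSite a h q - hcpSite a h p) (u q - u p)) ^ 2))) +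
      (∑' q, p1SiteBare a h (fun y k l => κ * ((7 * (5 / 4 : ℝ) + 3 / 4) / 4) * fpChi (R1 ^ 2) (R2 ^ 2) (y - fun k => hcpSite a h p k) ^ 2 *
        (fpSq (y - fun k => hcpSite a h p k))⁻¹ ^ 5 * ((y - fun k => hcpSite a h p k) k * (y - fun k => hcpSite a h p k) l)) V q) -
      (∑' q, p1SiteBare a h (fun y k l => κ * ((3 / 4 : ℝ) / 4) * fpChi (R1 ^ 2) (R2 ^ 2) (y - fun k => hcpSite a h p k) ^ 2 *
        (fpSq (y - fun k => hcpSite a h p k))⁻¹ ^ 4 * (if k = l then 1 else 0)) V q) := by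
    have hBs := stub_summableCorotatedBare a h ha hh u hu p W
    simp only [hR1', hRad] at hBs ⊢
    -- summability of the two hat-averaged families
    set Wrad : (Fin 3 → ℝ) → Fin 3 → Fin 3 → ℝ := fun y k l => κ * ((7 * (5 / 4 : ℝ) + 3 / 4) / 4) * fpChi (R1 ^ 2) (R2 ^ 2) (y - fun k => hcpSite a h p k) ^ 2 *
        (fpSq (y - fun k => hcpSite a h p k))⁻¹ ^ 5 * ((y - fun k => hcpSite a h p k) k * (y - fun k => hcpSite a h p k) l) with hWrad
    set Wcred : (Fin 3 → ℝ) → Fin 3 → Fin 3 → ℝ := fun y k l => κ * ((3 / 4 : ℝ) / 4) * fpChi (R1 ^ 2) (R2 ^ 2) (y - fun k => hcpSite a h p k) ^ 2 *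
        (fpSq (y - fun k => hcpSite a h p k))⁻¹ ^ 4 * (if k = l then 1 else 0) with hWcred
    have hc1 : 0 ≤ κ * ((7 * (5 / 4 : ℝ) + 3 / 4) / 4) := by positivity
    have hc2 : 0 ≤ κ * ((3 / 4 : ℝ) / 4) := by positivity
    have hSrad : Summable (p1SiteBare a h Wrad V) :=
      (tsum_p1SiteBare_le_fun_p1DispSite ha hh Wrad (continuous_radWeight_translate hS1 hS12 _ _)
        (fun y v => p1Quad3_radWeight_nonneg hc1 _ _ (y - fun k => hcpSite a h p k) v)
        (continuous_bareMajorant_translate hS1 hS12 _ _) (fun y v => p1Quad3_radWeight_le hc1 _ _ (y - fun k => hcpSite a h p k) v)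
        (integrable_bareMajorant_growth_translate hS1 hS12 _ hc1 _) _ hU b₀ A).1
    have hScred : Summable (p1SiteBare a h Wcred V) :=
      (tsum_p1SiteBare_le_fun_p1DispSite ha hh Wcred (continuous_credWeight_translate hS1 hS12 _ _)
        (fun y v => p1Quad3_credWeight_nonneg hc2 _ _ (y - fun k => hcpSite a h p k) v)
        (continuous_bareMajorant_translate hS1 hS12 _ _) (fun y v => p1Quad3_credWeight_le _ _ _ (y - fun k => hcpSite a h p k) v)
        (integrable_bareMajorant_growth_translate hS1 hS12 _ hc2 _) _ hU b₀ A).1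
    set bare : (ℤ × ℤ × ℤ) → ℝ := fun q => if q = p then (0 : ℝ) else
        1 / 2 * (ljSqDeriv (‖hcpSite a h q - hcpSite a h p‖ ^ 2) * fpSq (V q) +
          2 * (1 / 2 * (7 * ((‖hcpSite a h q - hcpSite a h p‖ ^ 2)⁻¹) ^ 8 -
            4 * ((‖hcpSite a h q - hcpSite a h p‖ ^ 2)⁻¹) ^ 5)) * p1NRad a h p V q ^ 2) with hbare
    set Θ : (ℤ × ℤ × ℤ) → ℝ := fun q => bare q + p1SiteBare a h Wrad V q - p1SiteBare a h Wcred V q with hΘ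
    have hΘs : Summable Θ := (hBs.add hSrad).sub hScred
    have hΘsum : ∑' q, Θ q = (∑' q, bare q) + (∑' q, p1SiteBare a h Wrad V q) - ∑' q, p1SiteBare a h Wcred V q := by
      rw [hΘ, ((hBs.add hSrad).tsum_sub hScred), hBs.tsum_add hSrad]
    -- Θ ≥ 0 off QB, and ≥ the near summand on QB
    have hΘp : Θ p = 0 := by
      simp only [hΘ, hbare, if_true, p1SiteBare_eq_zero_of_apply a h _ hVp, add_zero, sub_self]
    have hΘV : ∀ q, Θ q = bare q + p1SiteBare a h Wrad (fun _ => V q) q - p1SiteBare a h Wcred (fun _ => V q) q := by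
      intro q
      rw [hΘ]
      dsimp only
      rw [← p1SiteBare_congr_apply, ← p1SiteBare_congr_apply]
    have hRadc : ∀ q, p1NRad a h p (fun _ => V q) q = p1NRad a h p V q := fun q => rfl
    have hΘnn : ∀ q, q ∉ QB → 0 ≤ Θ q := by
      intro q hq
      by_cases hqp : q = p
      · rw [hqp, hΘp]
      · have h1 := hS q hq hqp (V q)
        rw [hRadc] at h1
        rw [hΘV, hbare]
        dsimp only
        rw [if_neg hqp]
        exact h1
    have hΘge : ∑ q ∈ QB, Θ q ≤ ∑' q, Θ q := by
      rw [← hΘs.sum_add_tsum_compl (s := QB), le_add_iff_nonneg_right]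
      refine tsum_nonneg fun q => hΘnn q.1 ?_
      have h2 := q.2
      rw [Set.mem_compl_iff, Finset.mem_coe] at h2
      exact h2
    have hnear : p1NearBare a h p QB L U V ≤ ∑ q ∈ QB, Θ q := by
      rw [p1NearBare]
      refine Finset.sum_le_sum fun q hq => ?_
      by_cases hqp : q = p
      · rw [if_pos hqp, hqp, hΘp]
      · rw [if_neg hqp, hΘV, hbare]
        dsimp only
        rw [if_neg hqp]
        obtain ⟨h1, h2⟩ := hTab q hq hqp (V q)
        rw [hRadc] at h1
        linarith
    linarith [hnear, hΘge, hΘsum]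
  -- (12) conclude
  have hform : p1NearForm a h κ₁ κ₃ κ p Y₁ β M₁ N w sv wv colβ SH QB QT QF LEG L U PAYM Δ FL0 V =
      p1NearBare a h p QB L U V + p1NearTransfer a h p M₁ N QT V - p1NearShell a h κ₁ κ₃ p SH V -
        p1NearRead p Y₁ β w sv wv colβ LEG V - p1NearPay a h p PAYM V - κ * p1NearFlux FL0 Δ QF V := rfl
  linarith [hShell, hTr, hFl, hPay, hRead, hBare, hnc, hform]

end Summit.AtomisticToContinuum.Crystallization.Theorems.StrictSplittingRuleBirth

end
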